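import Summits.BirchSwinnertonDyer.BirchSwinnertonDyer.Theorems.AdditiveBranchIMCGordTwoRankOneSplitGlue

/-!
# K1 route `AdditiveBranchIMC` — glue item 19500 `GordTwoRankOneOfParts` of the tenure split (spec (b′))
# of crux `GordTwoRankOne` (item 19358), PROVED OUTRIGHT (cell `bsd-addord`, seat `bsd-addord-k1-c3` gen 3)

Item `stmt-BirchSwinnertonDyer-19500` (support, GLUE of the gen-1 split of crux 19358, planner g15 rev 7):
`GordTwoRankOneOfParts := PrintedAndReadingFacts → MazurUniversalNormIndex → DisegniDelbourgoCycLineGrossZagier →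
DisegniDelbourgoCycLineGrossZagierThree → RankinSelbergBaseChangeDirichlet → GrossZagierRationalPointI73 →
WaldspurgerHeegnerTwistNonvanishing → DelbourgoLeadingTermMain → DelbourgoLeadingTermMainThree →
NewformOfEllipticCurve → LiLiuTianCMRankOne → GordTwoLambdaEven → GordTwoLambdaOdd → GordTwoRankOneClassCert →
GordTwoRankOne`.

The fourteen children are, by construction of the split, exactly the fifteen binders of this seat's gen-2
theorem `gordTwoRankOne_of_parts` (`…Theorems.AdditiveBranchIMCGordTwoRankOneSplitGlue`, p425970) with
`PrintedFacts` / `ReadingFacts` paired into the one alias child `PrintedAndReadingFacts`; every alias leaf is a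
`def X : Prop := <Literature fact>` unfolding definitionally to the corresponding binder, and the three content
children `GordTwoLambdaEven` / `GordTwoLambdaOdd` / `GordTwoRankOneClassCert` are the displayed hypotheses `hΛ` /
`hΛ'` / `hCert` verbatim. So the glue is the three-line wrapper of the planner's sketch (plan g15
`splits/Sketch19358.lean`), landed against the route declaration.

HONEST FRAMING. No mathematics of the crux is touched here: the content children 19497 / 19498 (Λ-adic branch
containment off Case 1, NOT in print) and 19499 (non-CM rank-1 class certificate `A′ ≠ 0`, Schneider-type) remain
OPEN, and so does BSD; closing the glue only certifies that the children imply the parent BY NAME.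
-/

set_option autoImplicit false
set_option linter.dupNamespace false

namespace Summit.BirchSwinnertonDyer.BirchSwinnertonDyer.Theorems.AdditiveBranchIMCGordTwoRankOne

open Summit.BirchSwinnertonDyer.BirchSwinnertonDyer.Theses.AdditiveBranchIMC

/-- **Glue item 19500, proved outright**: the fourteen split children of crux `GordTwoRankOne` imply it, by
`gordTwoRankOne_of_parts` (gen 2, p425970) applied to the children in order, the alias pair
`PrintedAndReadingFacts` split into its two components. Pure bookkeeping; nothing about any curve is asserted.
[cite: Delbourgo2002, Theorem (A), (B) (p. 40)] [cite: Disegni2017, Theorem B] [cite: LiLiuTian2024, Thm. 1.1 (i)]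
[cite: Miller2011LMS, Def. 1.1] -/
theorem gordTwoRankOneOfParts_proof : GordTwoRankOneOfParts := by
  unfold GordTwoRankOneOfParts
  intro h1 h2 h3 h4 h5 h6 h7 h8 h9 h10 h11 h12 h13 h14
  exact gordTwoRankOne_of_parts h1.1 h1.2 h2 h3 h4 h5 h6 h7 h8 h9 h10 h11 h12 h13 h14

end Summit.BirchSwinnertonDyer.BirchSwinnertonDyer.Theorems.AdditiveBranchIMCGordTwoRankOne
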